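import Summits.RiemannHypothesis.RiemannHypothesis.Theorems.WeilFormatCEntry
import Literature.NumberTheory.LFunctions.YoshidaWindowGram
import Summits.RiemannHypothesis.RiemannHypothesis.Theorems.WeilFormatCSectorSplit
import Summits.RiemannHypothesis.RiemannHypothesis.Theorems.WeilFormatCWindowDictionary
import HarnessLib

/-!
# Format C, entry theorem (L-C1) — VIII: the entry theorem with Yoshida's coefficients by name

Helper file of the rh-explicit Weil-positivity programme (`--supports stmt-RiemannHypothesis-0098`; seat
rh-explicit-weil-2), RH-free, no definitions, no named facts.

`WeilFormatCEntry.lean` proves `weilWindowForm a (Σ c_nχ_n) = Σ_nΣ_m Re(conj c_n·c_m)·G(n,m)` with `G` written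
inline; `Literature/NumberTheory/LFunctions/YoshidaWindowGram.lean` names the same coefficients as printed in
Yoshida 1992 §5 (5.15)/(5.16) (`Yoshida1992.gramCoeff = polarCoeff + primeCoeff + archCoeff`).  The two agree
definitionally; this file records the named form, which is the interface the format-C (E) evaluators quote
(`|gramCoeff a n m · 2^{2C} − mid_{nm}| ≤ ρ`) and which weil-3's dictionary consumes on `s = modes N`.

References: H. Yoshida, Adv. Stud. Pure Math. 21 (1992) 281–325, §5 (5.15)/(5.16) p. 301 [Yoshida1992HermitianForms].
-/

set_option linter.dupNamespace false

noncomputable section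

open Complex Finset
open scoped Real ComplexConjugate BigOperators

namespace Summit.RiemannHypothesis.RiemannHypothesis.Theorems.WeilFormatC

open Literature.NumberTheory.LFunctions Literature.NumberTheory.LFunctions.Yoshida1992
  Literature.Analysis.SpecialFunctions

/-- **L-C1 with Yoshida's coefficients by name**: for `a > 0`, every finite set of modes `s` and coefficients `c`,
`weilWindowForm a (Σ_{n∈s} c_nχ_n) = Σ_nΣ_m Re(conj c_n·c_m)·gramCoeff a n m` (Yoshida (5.15)/(5.16)). -/
theorem weilWindowForm_sum_smul_chi_eq_gramCoeff {a : ℝ} (ha : 0 < a) (s : Finset ℤ) (c : ℤ → ℂ) :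
    weilWindowForm a (∑ n ∈ s, c n • chi a n) =
      ∑ n ∈ s, ∑ m ∈ s, (conj (c n) * c m).re * gramCoeff a n m := by
  rw [weilWindowForm_sum_smul_chi_eq_explicit ha]
  rfl

/-- The same on Yoshida's `W_N = span{χ_n : |n| ≤ N}` (`s = modes N`, the shape of weil-3's dictionary
`weilPositivityOn_of_weilWindowForm_sum_chi_nonneg`). -/
theorem weilWindowForm_sum_modes_smul_chi_eq_gramCoeff {a : ℝ} (ha : 0 < a) (N : ℕ) (c : ℤ → ℂ) :
    weilWindowForm a (∑ n ∈ modes N, c n • chi a n) =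
      ∑ n ∈ modes N, ∑ m ∈ modes N, (conj (c n) * c m).re * gramCoeff a n m :=
  weilWindowForm_sum_smul_chi_eq_gramCoeff ha _ c

/-- **Positivity transfer**: if the real symmetric matrix `(gramCoeff a n m)_{n,m ∈ s}` is positive semidefinite as a
Hermitian form (`0 ≤ Σ_nΣ_m Re(conj c_n c_m) gramCoeff a n m` for all `c`), the window form is nonnegative on every
trigonometric window with modes in `s`. -/
theorem weilWindowForm_sum_smul_chi_nonneg_of_gramCoeff {a : ℝ} (ha : 0 < a) (s : Finset ℤ)
    (hpsd : ∀ c : ℤ → ℂ, 0 ≤ ∑ n ∈ s, ∑ m ∈ s, (conj (c n) * c m).re * gramCoeff a n m) (c : ℤ → ℂ) :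
    0 ≤ weilWindowForm a (∑ n ∈ s, c n • chi a n) := by
  rw [weilWindowForm_sum_smul_chi_eq_gramCoeff ha]
  exact hpsd c


/-! ## The printed pair sum of (5.16) -/

/-- **Yoshida's off-diagonal exponential sum as printed** ((5.16), third line): for `ω_n ≠ ω_m`,
`Σ_{k≥0} e^{−2a l_k}(l_k² − ω_nω_m)/((l_k² + ω_n²)(l_k² + ω_m²)) = (archExpSumSin a n − archExpSumSin a m)/(ω_n − ω_m)`
(term-wise partial fractions), so `archCoeff`'s off-diagonal `−(T_m − T_n)/(π(n−m))`-term, `T = archExpSumSin`,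
is the printed `−(1/a)Σ_k(…)` since `ω_n − ω_m = π(n − m)/a`. -/
theorem tsum_exp_mul_pair_eq {a : ℝ} (ha : 0 < a) {n m : ℤ} (hnm : freq a n ≠ freq a m) :
    ∑' k : ℕ, Real.exp (-(2 * a * digammaNode k)) *
        ((digammaNode k ^ 2 - freq a n * freq a m) /
          ((digammaNode k ^ 2 + freq a n ^ 2) * (digammaNode k ^ 2 + freq a m ^ 2))) =
      (archExpSumSin a n - archExpSumSin a m) / (freq a n - freq a m) := by
  have hsub : freq a n - freq a m ≠ 0 := sub_ne_zero.2 hnm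
  have hterm : ∀ k : ℕ, Real.exp (-(2 * a * digammaNode k)) *
      ((digammaNode k ^ 2 - freq a n * freq a m) /
        ((digammaNode k ^ 2 + freq a n ^ 2) * (digammaNode k ^ 2 + freq a m ^ 2))) =
      (Real.exp (-(2 * a * digammaNode k)) * (freq a n / (digammaNode k ^ 2 + freq a n ^ 2)) -
        Real.exp (-(2 * a * digammaNode k)) * (freq a m / (digammaNode k ^ 2 + freq a m ^ 2))) /
        (freq a n - freq a m) := by
    intro k
    have h1 : digammaNode k ^ 2 + freq a n ^ 2 ≠ 0 := by have := digammaNode_pos k; positivity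
    have h2 : digammaNode k ^ 2 + freq a m ^ 2 ≠ 0 := by have := digammaNode_pos k; positivity
    field_simp
    ring
  simp_rw [hterm]
  rw [tsum_div_const, (summable_s0 ha (freq a n)).tsum_sub (summable_s0 ha (freq a m))]
  rfl


/-! ## Reflection symmetry `G(−n,−m) = G(n,m)` of Yoshida's matrix -/

/-- `ω_{−n} = −ω_n`. -/
theorem freq_neg (a : ℝ) (n : ℤ) : freq a (-n) = -freq a n := by
  unfold freq; push_cast; ring

/-- `(−1)^{−n−m} = (−1)^{n+m}` in `ℝ`. -/
theorem neg_one_zpow_neg_add_neg (n m : ℤ) : (-1 : ℝ) ^ (-n + -m) = (-1) ^ (n + m) := by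
  rw [show -n + -m = -(n + m) by ring]
  rcases Int.even_or_odd (n + m) with h | h
  · rw [h.neg_one_zpow, h.neg.neg_one_zpow]
  · rw [h.neg_one_zpow, h.neg.neg_one_zpow]

/-- `POL(−n,−m) = POL(n,m)`. -/
theorem polarCoeff_neg_neg (a : ℝ) (n m : ℤ) : polarCoeff a (-n) (-m) = polarCoeff a n m := by
  unfold polarCoeff
  rw [freq_neg, freq_neg, neg_one_zpow_neg_add_neg]
  ring

/-- `K_t(−n,−m) = K_t(n,m)`. -/
theorem incrCoeff_neg_neg (a t : ℝ) (n m : ℤ) : incrCoeff a t (-n) (-m) = incrCoeff a t n m := by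
  unfold incrCoeff
  by_cases h : n = m
  · subst h
    simp only [if_true, freq_neg, neg_mul, Real.cos_neg]
  · have hd : (π * (((-n : ℤ) : ℝ) - ((-m : ℤ) : ℝ))) = -(π * ((n : ℝ) - m)) := by push_cast; ring
    rw [if_neg (fun h' ↦ h (neg_inj.1 h')), if_neg h, freq_neg, freq_neg, neg_one_zpow_neg_add_neg, hd]
    simp only [neg_mul, Real.sin_neg, div_neg]
    ring

/-- `PRI(−n,−m) = PRI(n,m)`. -/
theorem primeCoeff_neg_neg (a : ℝ) (n m : ℤ) : primeCoeff a (-n) (-m) = primeCoeff a n m := by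
  unfold primeCoeff
  refine Finset.sum_congr rfl fun k _ ↦ ?_
  rw [incrCoeff_neg_neg]
  by_cases h : n = m
  · subst h; simp
  · rw [if_neg (fun h' ↦ h (neg_inj.1 h')), if_neg h]

/-- The diagonal exponential sum is even in the mode. -/
theorem archExpSumDiag_neg (a : ℝ) (n : ℤ) : archExpSumDiag a (-n) = archExpSumDiag a n := by
  unfold archExpSumDiag; simp only [freq_neg, neg_sq]

/-- The off-diagonal exponential sum is odd in the mode. -/
theorem archExpSumSin_neg (a : ℝ) (n : ℤ) : archExpSumSin a (-n) = -archExpSumSin a n := by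
  unfold archExpSumSin
  rw [← tsum_neg]
  refine tsum_congr fun k ↦ ?_
  rw [freq_neg, neg_sq]
  ring

/-- `Re ψ′(¼ − iω/2) = Re ψ′(¼ + iω/2)` (the series `Σ 4(l_k² − ω²)/(l_k² + ω²)²` is even in `ω`). -/
theorem re_deriv_digamma_quarter_neg (ω : ℝ) :
    (deriv Complex.digamma (1 / 4 + (((-ω : ℝ)) : ℂ) / 2 * I)).re =
      (deriv Complex.digamma (1 / 4 + (ω : ℂ) / 2 * I)).re :=
  (hasSum_re_deriv_digamma_quarter (-ω)).unique
    ((hasSum_re_deriv_digamma_quarter ω).congr_fun fun k ↦ by rw [neg_sq])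

/-- `Im ψ(¼ − iω/2) = −Im ψ(¼ + iω/2)` (the series `Σ 2ω/(l_k² + ω²)` is odd in `ω`). -/
theorem im_digamma_quarter_neg (ω : ℝ) :
    (Complex.digamma (1 / 4 + (((-ω : ℝ)) : ℂ) / 2 * I)).im = -(Complex.digamma (1 / 4 + (ω : ℂ) / 2 * I)).im :=
  (hasSum_im_digamma_quarter (-ω)).unique
    ((hasSum_im_digamma_quarter ω).neg.congr_fun fun k ↦ by rw [neg_sq]; ring)

/-- `ARCH(−n,−m) = ARCH(n,m)`. -/
theorem archCoeff_neg_neg (a : ℝ) (n m : ℤ) : archCoeff a (-n) (-m) = archCoeff a n m := by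
  unfold archCoeff
  by_cases h : n = m
  · subst h
    simp only [if_true]
    rw [archExpSumDiag_neg, freq_neg, reDigammaQuarter_even, re_deriv_digamma_quarter_neg]
  · rw [if_neg (fun h' ↦ h (neg_inj.1 h')), if_neg h, archExpSumSin_neg, archExpSumSin_neg, freq_neg, freq_neg,
      im_digamma_quarter_neg, im_digamma_quarter_neg, neg_one_zpow_neg_add_neg]
    have hd : (π * (((-n : ℤ) : ℝ) - ((-m : ℤ) : ℝ))) = -(π * ((n : ℝ) - m)) := by push_cast; ring
    rw [hd]
    simp only [div_neg, neg_div]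
    ring

/-- **`(χ_{−n}, χ_{−m}) = (χ_n, χ_m)`**: Yoshida's matrix is invariant under the reflection `n ↦ −n`
(the Weil form is invariant under `u ↦ u(−x)` and real on real functions). -/
theorem gramCoeff_neg_neg (a : ℝ) (n m : ℤ) : gramCoeff a (-n) (-m) = gramCoeff a n m := by
  rw [gramCoeff, gramCoeff, polarCoeff_neg_neg, primeCoeff_neg_neg, archCoeff_neg_neg]

/-! ## End to end: two families of real PSD certificates ⇒ `WeilPositivityOn a` -/

/-- **Format C, end to end.**  Let `a > 0`.  If for every `N` the EVEN sector matrix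
`M⁺_N(0,m) = G(0,m)`, `M⁺_N(n,0) = G(n,0)`, `M⁺_N(n,m) = (G(n,m) + G(n,−m))/2` (`1 ≤ n,m ≤ N`, indices in
`range (N+1)`) and the ODD sector matrix `M⁻_N(k,l) = (G(k+1,l+1) − G(k+1,−(l+1)))/2` (indices in `range N`) of
Yoshida's matrix `G = gramCoeff a` are positive semidefinite as real quadratic forms, then Weil's quadratic
functional is nonnegative on every test function supported in `[−a, a]`: `WeilPositivityOn a`
(L-C1 `weilWindowForm_sum_smul_chi_eq_explicit` + sector split + weil-3's dictionary
`weilPositivityOn_of_weilWindowForm_sum_chi_nonneg`).  A format-C certificate proves the two PSD facts for one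
`N = M₁` by kernel arithmetic ((P) `PsdDyadic.checkPsdMid` + (E) enclosures of `gramCoeff`) and for all larger `N`
by the far-coercivity/Schur bound L-C3. -/
theorem weilPositivityOn_of_gramCoeff_sector_psd {a : ℝ} (ha : 0 < a)
    (hev : ∀ (N : ℕ) (y : ℕ → ℝ), 0 ≤ ∑ n ∈ Finset.range (N + 1), ∑ m ∈ Finset.range (N + 1),
      y n * y m * (if n = 0 then gramCoeff a 0 m else if m = 0 then gramCoeff a n 0
        else (gramCoeff a n m + gramCoeff a n (-(m : ℤ))) / 2))
    (hod : ∀ (N : ℕ) (z : ℕ → ℝ), 0 ≤ ∑ k ∈ Finset.range N, ∑ l ∈ Finset.range N,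
      z k * z l * ((gramCoeff a ((k : ℤ) + 1) ((l : ℤ) + 1) - gramCoeff a ((k : ℤ) + 1) (-((l : ℤ) + 1))) / 2)) :
    WeilPositivityOn a :=
  weilPositivityOn_of_weilWindowForm_sum_chi_nonneg ha fun N c ↦ by
    rw [weilWindowForm_sum_modes_smul_chi_eq_gramCoeff ha]
    exact sum_modes_re_conj_mul_nonneg_of_sectors (gramCoeff a) (gramCoeff_neg_neg a) N (hev N) (hod N) c

end Summit.RiemannHypothesis.RiemannHypothesis.Theorems.WeilFormatC
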